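/-
Copyright: the b2b-balaban T⁴-continuum CRUX team, row NE7b OWNER lineage `t4-ne7b-p1` (gen 136). Project licence.
-/
import Summits.QuantumFields.BalabanUV.T4Continuum.Spine.NE7b.SupQuadraticExtractionLine
import Summits.QuantumFields.BalabanUV.T4Continuum.Spine.NE7b.SupNextHessianMatrix

/-!
# THE EXTRACTED PARTS OF THE LINE FORMAT ARE `−⟨b_D,ζ⟩` AND `−ζᵀK_Dζ` — (α4), THE ROAD'S TAYLOR DATA IDENTIFIED WITH THE ABSORPTION INPUTS:
# the linear and quadratic Taylor parts `(log Z)′(0)`, `(log Z)″(0)` of the next potential along `ψ₀ + t·ζ` ((338)∕(386)) ARE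
#   `(log Z)′(0) = −⟨b_D(ψ₀), ζ⟩`   and   `(log Z)″(0) = −ζᵀK_D(ψ₀)ζ`
# with (388)'s vector `b_D(ψ₀)` and symmetric matrix `K_D(ψ₀)`, so the Taylor remainder reads
#   `r(ζ) = log Z(ψ₀+ζ) − log Z(ψ₀) + ⟨b_D,ζ⟩ + ½ζᵀK_Dζ`,   `|r(ζ)| ≤ C₃·√Q(ζ)·Q(ζ)`  (the cubic letter of (386) in these terms)
# — the format `Z(ψ₀+ζ) = Z(ψ₀)·e^{−⟨b_D,ζ⟩ − ½ζᵀK_Dζ}·e^{r(ζ)}` that (385)'s absorption consumes VERBATIM (row NE7b, node U5c;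
# (313)∕(320)∕(338)∕(386)∕(388) BY NAME; [folklore])

Cell `pub-balaban`, sub-cell `t4`, spine estimate NE7b (`T4WeightBudget.RelWeightBound`; the cell's OWN estimate — NOT PRINTED in
[Bałaban 1983–89], NOT PROVED).  Crux-route work under `Spine/NE7b/` by the row OWNER (`t4-ne7b-p1` gen 136, file (389)) under FREEZE
(0)'s crux-prover clause, on gen 135's SCOPING-d7 DECISION (d7′)(2′)(ii)∕(a)∕(b); NOTHING of Bałaban's is named as a Lean object, valued
or asserted; no `T4Continuum/Support` leaf typed; no `def`, no notation (`b_D`, `K_D` WRITTEN OUT as in (388)); zero `sorry`.  Imports (BY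
NAME): the OWNER's (386) `…SupQuadraticExtractionLine` (`cubic_letter_line`), (388) `…SupNextHessianMatrix` (`nextGradient_apply`,
`nextHessianMatrix_apply`), and through them (297) (`cellSum_eq_sum_biUnion`), (337b) (`lineZ_pos`).

WHAT IS PROVED ([folklore]; `Y = ⋃_{p∈C} cell p`, `Z(ψ) = ∫e^{−Σ_Y w_x(ω_x+ψ_x)}dN(0,Γ)`):
* §1 **`linearPart_eq`** (`(∫e^{−V(ψ₀)}·(−Σ_Y w′ζ))∕Z(ψ₀) = −⟨b_D(ψ₀),ζ⟩`), **`quadraticPart_eq`** ((338)'s second Taylor coefficient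
  `= −ζᵀK_D(ψ₀)ζ`), `remainder_eq` (the Taylor remainder of (338) IS `log Z(ψ₀+ζ) − log Z(ψ₀) + ⟨b_D,ζ⟩ + ½ζᵀK_Dζ`);
* §2 THE END **`dressed_remainder_cubic`**: under (338)'s hypotheses (tilted moment letters along the segment) and `0 ≤ L₁, L₂, L₃`,
  `|log Z(ψ₀+ζ) − log Z(ψ₀) + ⟨b_D(ψ₀),ζ⟩ + ½ζᵀK_D(ψ₀)ζ| ≤ C₃·√Q(ζ)·Q(ζ)` with (386)'s explicit `C₃` and `Q(ζ) = Σ_Y ζ²`; §3 toy.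

HONEST (what this is NOT).  Identifications and one triangle-free rewrite; the letters `L_k` are hypotheses (discharged on the road by (339));
no absorption (that is (385) + (387) + the successor's dressed step), no contraction; scalar skeleton ((A3), NC-NE7b-α UNRULED); nothing of
Bałaban's asserted.  BY-NAME EFFECT ON THE WALL: NONE.  NE7b NOT PRINTED ∕ NOT PROVED; spine PROVED 0∕9; rung (B)+1 — the programme's measures
remain FINITE-torus statements; NOT the mass gap, NOT Clay.  HONEST DEPENDENCY: continuum YM on T⁴ ⇐ BetaPertH ∧ nine spine estimates (0∕9
proved); BetaPertH ⇐ (D1) ∧ (D4) ∧ CAP+tail; G-an2-4 gates asym, D1 and NE2∕3∕4.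
-/

set_option autoImplicit false
set_option maxSynthPendingDepth 2

noncomputable section

namespace Summit.QuantumFields.BalabanUV.T4Continuum.NE7b.SupExtractedPartsIdentified

open MeasureTheory ProbabilityTheory Finset Real Matrix
open scoped BigOperators
open SupNextHessianMatrix (nextGradient_apply nextHessianMatrix_apply)
open SupQuadraticExtractionLine (cubic_letter_line)
open SupSmallFieldGasReal (cellSum_eq_sum_biUnion)
open SupNextPotentialThirdLetter (lineZ_pos)
open SupEffectiveActionDerivative (mul_opBound_le_of_le)

variable {ι : Type} [Fintype ι] [DecidableEq ι] {V : Type*}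

section Road

variable {Γ : Matrix ι ι ℝ} {γop : ℝ} {cell : V → Finset ι} {w w' w'' w₃ : ι → ℝ → ℝ} {κ₀ κ₁ κ₂ κ₃ τ δ θ : ℝ}

/-! ## §1. The linear and quadratic Taylor parts are `−⟨b_D,ζ⟩` and `−ζᵀK_Dζ` -/

/-- **THE LINEAR TAYLOR PART IS `−⟨b_D(ψ₀), ζ⟩`**: under (313)'s hypotheses,
`(∫e^{−V(ψ₀,ω)}·(−Σ_Y w′_x(ω_x+ψ₀,x)ζ_x) dN(0,Γ))∕Z(ψ₀) = −⟨b_D(ψ₀), ζ⟩`. [folklore] -/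
theorem linearPart_eq (hΓ : Γ.PosSemidef) (hΓop : (γop • (1 : Matrix ι ι ℝ) - Γ).PosSemidef)
    (hdisj : ∀ p q, p ≠ q → Disjoint (cell p) (cell q)) (hw' : ∀ x t, HasDerivAt (w x) (w' x t) t) (hw'm : ∀ x, Measurable (w' x))
    (hκ₀ : 0 ≤ κ₀) (hκ₁ : 0 ≤ κ₁) (hτ : 0 < τ) (hδ : 0 < δ) (hθ1 : θ < 1)
    (hκθ : (2 * κ₀ * (1 + τ) + 4 * δ) * γop ≤ θ) (hstab : ∀ x, ∀ t : ℝ, -(κ₀ * t ^ 2) ≤ w x t)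
    (hw'b : ∀ x t, |w' x t| ≤ κ₁ * |t|) (C : Finset V) (ψ₀ ζ : EuclideanSpace ℝ ι) :
    (∫ ω : EuclideanSpace ℝ ι, exp (-(∑ x ∈ C.biUnion cell, w x (ω x + ψ₀ x))) * -(∑ x ∈ C.biUnion cell, w' x (ω x + ψ₀ x) * ζ x) ∂(multivariateGaussian 0 Γ)) /
          (∫ ω : EuclideanSpace ℝ ι, exp (-(∑ x ∈ C.biUnion cell, w x (ω x + ψ₀ x))) ∂(multivariateGaussian 0 Γ)) =
      -((fun x : ι => ((∫ ω : EuclideanSpace ℝ ι, exp (-(∑ p ∈ C, ∑ x ∈ cell p, w x (ω x + ψ₀ x))) ∂(multivariateGaussian 0 Γ))⁻¹ •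
        ∫ ω : EuclideanSpace ℝ ι, exp (-(∑ p ∈ C, ∑ x ∈ cell p, w x (ω x + ψ₀ x))) •
          (∑ p ∈ C, ∑ x ∈ cell p, (w' x (ω x + ψ₀ x)) • (EuclideanSpace.proj x : EuclideanSpace ℝ ι →L[ℝ] ℝ))
          ∂(multivariateGaussian 0 Γ)) (EuclideanSpace.single x (1 : ℝ))) ⬝ᵥ (WithLp.ofLp ζ)) := by
  rw [nextGradient_apply hΓ hΓop hdisj hw' hw'm hκ₀ hκ₁ hτ hδ hθ1 hκθ hstab hw'b C ψ₀ ζ]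
  simp only [cellSum_eq_sum_biUnion cell hdisj C, mul_neg, integral_neg]
  rw [neg_div, div_eq_inv_mul]

/-- **THE QUADRATIC TAYLOR PART IS `−ζᵀK_D(ψ₀)ζ`**: under (320)'s hypotheses, (338)'s second Taylor coefficient
`((∫e^{−V}((Σw′ζ)² − Σw″ζ²))·Z − (∫e^{−V}(−Σw′ζ))²)∕Z²` equals `−ζᵀK_D(ψ₀)ζ`. [folklore] -/
theorem quadraticPart_eq (hΓ : Γ.PosSemidef) (hΓop : (γop • (1 : Matrix ι ι ℝ) - Γ).PosSemidef)
    (hdisj : ∀ p q, p ≠ q → Disjoint (cell p) (cell q)) (hw' : ∀ x t, HasDerivAt (w x) (w' x t) t) (hw'm : ∀ x, Measurable (w' x))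
    (hw''m : ∀ x, Measurable (w'' x)) (hκ₀ : 0 ≤ κ₀) (hκ₁ : 0 ≤ κ₁) (hτ : 0 < τ) (hδ : 0 < δ) (hθ0 : 0 < θ) (hθ1 : θ < 1)
    (hκθ : (2 * κ₀ * (1 + τ) + 4 * δ) * γop ≤ θ) (hstab : ∀ x, ∀ t : ℝ, -(κ₀ * t ^ 2) ≤ w x t) (hw'b : ∀ x t, |w' x t| ≤ κ₁ * |t|)
    (hw''b : ∀ x t, |w'' x t| ≤ κ₂) (C : Finset V) (ψ₀ ζ : EuclideanSpace ℝ ι) :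
    ((∫ ω : EuclideanSpace ℝ ι, exp (-(∑ x ∈ C.biUnion cell, w x (ω x + ψ₀ x))) * ((∑ x ∈ C.biUnion cell, w' x (ω x + ψ₀ x) * ζ x) * (∑ x ∈ C.biUnion cell, w' x (ω x + ψ₀ x) * ζ x) - (∑ x ∈ C.biUnion cell, w'' x (ω x + ψ₀ x) * ζ x ^ 2)) ∂(multivariateGaussian 0 Γ)) *
            (∫ ω : EuclideanSpace ℝ ι, exp (-(∑ x ∈ C.biUnion cell, w x (ω x + ψ₀ x))) ∂(multivariateGaussian 0 Γ)) -
          (∫ ω : EuclideanSpace ℝ ι, exp (-(∑ x ∈ C.biUnion cell, w x (ω x + ψ₀ x))) * -(∑ x ∈ C.biUnion cell, w' x (ω x + ψ₀ x) * ζ x) ∂(multivariateGaussian 0 Γ)) *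
            (∫ ω : EuclideanSpace ℝ ι, exp (-(∑ x ∈ C.biUnion cell, w x (ω x + ψ₀ x))) * -(∑ x ∈ C.biUnion cell, w' x (ω x + ψ₀ x) * ζ x) ∂(multivariateGaussian 0 Γ))) /
          (∫ ω : EuclideanSpace ℝ ι, exp (-(∑ x ∈ C.biUnion cell, w x (ω x + ψ₀ x))) ∂(multivariateGaussian 0 Γ)) ^ 2 =
      -((WithLp.ofLp ζ) ⬝ᵥ (Matrix.of fun x y : ι =>
      ((((∫ ω : EuclideanSpace ℝ ι, exp (-(∑ p ∈ C, ∑ x ∈ cell p, w x (ω x + ψ₀ x))) ∂(multivariateGaussian 0 Γ))⁻¹ •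
          (∫ ω : EuclideanSpace ℝ ι, exp (-(∑ p ∈ C, ∑ x ∈ cell p, w x (ω x + ψ₀ x))) •
            ((∑ p ∈ C, ∑ x ∈ cell p, (w'' x (ω x + ψ₀ x)) • ((EuclideanSpace.proj x : EuclideanSpace ℝ ι →L[ℝ] ℝ).smulRight
                (EuclideanSpace.proj x : EuclideanSpace ℝ ι →L[ℝ] ℝ))) -
              (∑ p ∈ C, ∑ x ∈ cell p, (w' x (ω x + ψ₀ x)) • (EuclideanSpace.proj x : EuclideanSpace ℝ ι →L[ℝ] ℝ)).smulRight
                (∑ p ∈ C, ∑ x ∈ cell p, (w' x (ω x + ψ₀ x)) • (EuclideanSpace.proj x : EuclideanSpace ℝ ι →L[ℝ] ℝ)))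
            ∂(multivariateGaussian 0 Γ)) +
        (((∫ ω : EuclideanSpace ℝ ι, exp (-(∑ p ∈ C, ∑ x ∈ cell p, w x (ω x + ψ₀ x))) ∂(multivariateGaussian 0 Γ)) ^ 2)⁻¹ •
          ∫ ω : EuclideanSpace ℝ ι, exp (-(∑ p ∈ C, ∑ x ∈ cell p, w x (ω x + ψ₀ x))) •
            (∑ p ∈ C, ∑ x ∈ cell p, (w' x (ω x + ψ₀ x)) • (EuclideanSpace.proj x : EuclideanSpace ℝ ι →L[ℝ] ℝ))
            ∂(multivariateGaussian 0 Γ)).smulRight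
          (∫ ω : EuclideanSpace ℝ ι, exp (-(∑ p ∈ C, ∑ x ∈ cell p, w x (ω x + ψ₀ x))) •
            (∑ p ∈ C, ∑ x ∈ cell p, (w' x (ω x + ψ₀ x)) • (EuclideanSpace.proj x : EuclideanSpace ℝ ι →L[ℝ] ℝ))
            ∂(multivariateGaussian 0 Γ)))
          (EuclideanSpace.single x (1 : ℝ)) (EuclideanSpace.single y (1 : ℝ)) +
        ((∫ ω : EuclideanSpace ℝ ι, exp (-(∑ p ∈ C, ∑ x ∈ cell p, w x (ω x + ψ₀ x))) ∂(multivariateGaussian 0 Γ))⁻¹ •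
          (∫ ω : EuclideanSpace ℝ ι, exp (-(∑ p ∈ C, ∑ x ∈ cell p, w x (ω x + ψ₀ x))) •
            ((∑ p ∈ C, ∑ x ∈ cell p, (w'' x (ω x + ψ₀ x)) • ((EuclideanSpace.proj x : EuclideanSpace ℝ ι →L[ℝ] ℝ).smulRight
                (EuclideanSpace.proj x : EuclideanSpace ℝ ι →L[ℝ] ℝ))) -
              (∑ p ∈ C, ∑ x ∈ cell p, (w' x (ω x + ψ₀ x)) • (EuclideanSpace.proj x : EuclideanSpace ℝ ι →L[ℝ] ℝ)).smulRight
                (∑ p ∈ C, ∑ x ∈ cell p, (w' x (ω x + ψ₀ x)) • (EuclideanSpace.proj x : EuclideanSpace ℝ ι →L[ℝ] ℝ)))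
            ∂(multivariateGaussian 0 Γ)) +
        (((∫ ω : EuclideanSpace ℝ ι, exp (-(∑ p ∈ C, ∑ x ∈ cell p, w x (ω x + ψ₀ x))) ∂(multivariateGaussian 0 Γ)) ^ 2)⁻¹ •
          ∫ ω : EuclideanSpace ℝ ι, exp (-(∑ p ∈ C, ∑ x ∈ cell p, w x (ω x + ψ₀ x))) •
            (∑ p ∈ C, ∑ x ∈ cell p, (w' x (ω x + ψ₀ x)) • (EuclideanSpace.proj x : EuclideanSpace ℝ ι →L[ℝ] ℝ))
            ∂(multivariateGaussian 0 Γ)).smulRight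
          (∫ ω : EuclideanSpace ℝ ι, exp (-(∑ p ∈ C, ∑ x ∈ cell p, w x (ω x + ψ₀ x))) •
            (∑ p ∈ C, ∑ x ∈ cell p, (w' x (ω x + ψ₀ x)) • (EuclideanSpace.proj x : EuclideanSpace ℝ ι →L[ℝ] ℝ))
            ∂(multivariateGaussian 0 Γ)))
          (EuclideanSpace.single y (1 : ℝ)) (EuclideanSpace.single x (1 : ℝ))) / 2)) *ᵥ (WithLp.ofLp ζ)) := by
  rw [nextHessianMatrix_apply hΓ hΓop hdisj hw' hw'm hw''m hκ₀ hκ₁ hτ hδ hθ1 hκθ hstab hw'b hw''b C ψ₀ ζ]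
  have hw : ∀ x, Measurable (w x) := fun x => (continuous_iff_continuousAt.2 fun t => (hw' x t).continuousAt).measurable
  have hκθ₀ : 2 * κ₀ * (1 + τ) * γop ≤ θ := mul_opBound_le_of_le (by positivity) (by linarith) hθ0.le hκθ
  have hZ := (lineZ_pos hΓ hΓop (C.biUnion cell) hw hκ₀ hτ hθ1 hκθ₀ hstab (WithLp.ofLp ψ₀) (WithLp.ofLp ζ) 0).2
  simp only [zero_mul, add_zero] at hZ
  -- the two sign flips under the integral
  have i1 : (∫ ω : EuclideanSpace ℝ ι, exp (-(∑ x ∈ C.biUnion cell, w x (ω x + ψ₀ x))) * ((∑ x ∈ C.biUnion cell, w' x (ω x + ψ₀ x) * ζ x) * (∑ x ∈ C.biUnion cell, w' x (ω x + ψ₀ x) * ζ x) - (∑ x ∈ C.biUnion cell, w'' x (ω x + ψ₀ x) * ζ x ^ 2)) ∂(multivariateGaussian 0 Γ)) =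
      -(∫ ω : EuclideanSpace ℝ ι, exp (-(∑ x ∈ C.biUnion cell, w x (ω x + ψ₀ x))) *
        ((∑ x ∈ C.biUnion cell, w'' x (ω x + ψ₀ x) * ζ x * ζ x) -
          (∑ x ∈ C.biUnion cell, w' x (ω x + ψ₀ x) * ζ x) * (∑ x ∈ C.biUnion cell, w' x (ω x + ψ₀ x) * ζ x)) ∂(multivariateGaussian 0 Γ)) := by
    rw [← integral_neg]
    refine integral_congr_ae (ae_of_all _ fun ω => ?_)
    dsimp only
    have e : ∑ x ∈ C.biUnion cell, w'' x (ω x + ψ₀ x) * ζ x ^ 2 = ∑ x ∈ C.biUnion cell, w'' x (ω x + ψ₀ x) * ζ x * ζ x :=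
      Finset.sum_congr rfl fun x _ => by ring
    rw [e]; ring
  have i2 : (∫ ω : EuclideanSpace ℝ ι, exp (-(∑ x ∈ C.biUnion cell, w x (ω x + ψ₀ x))) * -(∑ x ∈ C.biUnion cell, w' x (ω x + ψ₀ x) * ζ x) ∂(multivariateGaussian 0 Γ)) =
      -(∫ ω : EuclideanSpace ℝ ι, exp (-(∑ x ∈ C.biUnion cell, w x (ω x + ψ₀ x))) *
        (∑ x ∈ C.biUnion cell, w' x (ω x + ψ₀ x) * ζ x) ∂(multivariateGaussian 0 Γ)) := by
    rw [← integral_neg]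
    refine integral_congr_ae (ae_of_all _ fun ω => ?_)
    dsimp only
    ring
  rw [i1, i2]
  simp only [cellSum_eq_sum_biUnion cell hdisj C]
  field_simp
  ring

/-- **THE TAYLOR REMAINDER IN ABSORPTION TERMS**: (338)'s remainder `log Z(ψ₀+ζ) − log Z(ψ₀) − (log Z)′(0) − ½(log Z)″(0)` IS
`log Z(ψ₀+ζ) − log Z(ψ₀) + ⟨b_D(ψ₀),ζ⟩ + ½ζᵀK_D(ψ₀)ζ`. [folklore] -/
theorem remainder_eq (hΓ : Γ.PosSemidef) (hΓop : (γop • (1 : Matrix ι ι ℝ) - Γ).PosSemidef)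
    (hdisj : ∀ p q, p ≠ q → Disjoint (cell p) (cell q)) (hw' : ∀ x t, HasDerivAt (w x) (w' x t) t) (hw'm : ∀ x, Measurable (w' x))
    (hw''m : ∀ x, Measurable (w'' x)) (hκ₀ : 0 ≤ κ₀) (hκ₁ : 0 ≤ κ₁) (hτ : 0 < τ) (hδ : 0 < δ) (hθ0 : 0 < θ) (hθ1 : θ < 1)
    (hκθ : (2 * κ₀ * (1 + τ) + 4 * δ) * γop ≤ θ) (hstab : ∀ x, ∀ t : ℝ, -(κ₀ * t ^ 2) ≤ w x t) (hw'b : ∀ x t, |w' x t| ≤ κ₁ * |t|)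
    (hw''b : ∀ x t, |w'' x t| ≤ κ₂) (C : Finset V) (ψ₀ ζ : EuclideanSpace ℝ ι) :
    Real.log (∫ ω : EuclideanSpace ℝ ι, exp (-(∑ x ∈ C.biUnion cell, w x (ω x + (ψ₀ x + ζ x)))) ∂(multivariateGaussian 0 Γ)) -
          Real.log (∫ ω : EuclideanSpace ℝ ι, exp (-(∑ x ∈ C.biUnion cell, w x (ω x + ψ₀ x))) ∂(multivariateGaussian 0 Γ)) -
        (∫ ω : EuclideanSpace ℝ ι, exp (-(∑ x ∈ C.biUnion cell, w x (ω x + ψ₀ x))) * -(∑ x ∈ C.biUnion cell, w' x (ω x + ψ₀ x) * ζ x) ∂(multivariateGaussian 0 Γ)) /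
          (∫ ω : EuclideanSpace ℝ ι, exp (-(∑ x ∈ C.biUnion cell, w x (ω x + ψ₀ x))) ∂(multivariateGaussian 0 Γ)) -
        ((∫ ω : EuclideanSpace ℝ ι, exp (-(∑ x ∈ C.biUnion cell, w x (ω x + ψ₀ x))) * ((∑ x ∈ C.biUnion cell, w' x (ω x + ψ₀ x) * ζ x) * (∑ x ∈ C.biUnion cell, w' x (ω x + ψ₀ x) * ζ x) - (∑ x ∈ C.biUnion cell, w'' x (ω x + ψ₀ x) * ζ x ^ 2)) ∂(multivariateGaussian 0 Γ)) *
            (∫ ω : EuclideanSpace ℝ ι, exp (-(∑ x ∈ C.biUnion cell, w x (ω x + ψ₀ x))) ∂(multivariateGaussian 0 Γ)) -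
          (∫ ω : EuclideanSpace ℝ ι, exp (-(∑ x ∈ C.biUnion cell, w x (ω x + ψ₀ x))) * -(∑ x ∈ C.biUnion cell, w' x (ω x + ψ₀ x) * ζ x) ∂(multivariateGaussian 0 Γ)) *
            (∫ ω : EuclideanSpace ℝ ι, exp (-(∑ x ∈ C.biUnion cell, w x (ω x + ψ₀ x))) * -(∑ x ∈ C.biUnion cell, w' x (ω x + ψ₀ x) * ζ x) ∂(multivariateGaussian 0 Γ))) /
          (∫ ω : EuclideanSpace ℝ ι, exp (-(∑ x ∈ C.biUnion cell, w x (ω x + ψ₀ x))) ∂(multivariateGaussian 0 Γ)) ^ 2 / 2 =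
      Real.log (∫ ω : EuclideanSpace ℝ ι, exp (-(∑ x ∈ C.biUnion cell, w x (ω x + (ψ₀ x + ζ x)))) ∂(multivariateGaussian 0 Γ)) -
          Real.log (∫ ω : EuclideanSpace ℝ ι, exp (-(∑ x ∈ C.biUnion cell, w x (ω x + ψ₀ x))) ∂(multivariateGaussian 0 Γ)) +
        (fun x : ι => ((∫ ω : EuclideanSpace ℝ ι, exp (-(∑ p ∈ C, ∑ x ∈ cell p, w x (ω x + ψ₀ x))) ∂(multivariateGaussian 0 Γ))⁻¹ •
        ∫ ω : EuclideanSpace ℝ ι, exp (-(∑ p ∈ C, ∑ x ∈ cell p, w x (ω x + ψ₀ x))) •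
          (∑ p ∈ C, ∑ x ∈ cell p, (w' x (ω x + ψ₀ x)) • (EuclideanSpace.proj x : EuclideanSpace ℝ ι →L[ℝ] ℝ))
          ∂(multivariateGaussian 0 Γ)) (EuclideanSpace.single x (1 : ℝ))) ⬝ᵥ (WithLp.ofLp ζ) +
        (WithLp.ofLp ζ) ⬝ᵥ (Matrix.of fun x y : ι =>
      ((((∫ ω : EuclideanSpace ℝ ι, exp (-(∑ p ∈ C, ∑ x ∈ cell p, w x (ω x + ψ₀ x))) ∂(multivariateGaussian 0 Γ))⁻¹ •
          (∫ ω : EuclideanSpace ℝ ι, exp (-(∑ p ∈ C, ∑ x ∈ cell p, w x (ω x + ψ₀ x))) •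
            ((∑ p ∈ C, ∑ x ∈ cell p, (w'' x (ω x + ψ₀ x)) • ((EuclideanSpace.proj x : EuclideanSpace ℝ ι →L[ℝ] ℝ).smulRight
                (EuclideanSpace.proj x : EuclideanSpace ℝ ι →L[ℝ] ℝ))) -
              (∑ p ∈ C, ∑ x ∈ cell p, (w' x (ω x + ψ₀ x)) • (EuclideanSpace.proj x : EuclideanSpace ℝ ι →L[ℝ] ℝ)).smulRight
                (∑ p ∈ C, ∑ x ∈ cell p, (w' x (ω x + ψ₀ x)) • (EuclideanSpace.proj x : EuclideanSpace ℝ ι →L[ℝ] ℝ)))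
            ∂(multivariateGaussian 0 Γ)) +
        (((∫ ω : EuclideanSpace ℝ ι, exp (-(∑ p ∈ C, ∑ x ∈ cell p, w x (ω x + ψ₀ x))) ∂(multivariateGaussian 0 Γ)) ^ 2)⁻¹ •
          ∫ ω : EuclideanSpace ℝ ι, exp (-(∑ p ∈ C, ∑ x ∈ cell p, w x (ω x + ψ₀ x))) •
            (∑ p ∈ C, ∑ x ∈ cell p, (w' x (ω x + ψ₀ x)) • (EuclideanSpace.proj x : EuclideanSpace ℝ ι →L[ℝ] ℝ))
            ∂(multivariateGaussian 0 Γ)).smulRight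
          (∫ ω : EuclideanSpace ℝ ι, exp (-(∑ p ∈ C, ∑ x ∈ cell p, w x (ω x + ψ₀ x))) •
            (∑ p ∈ C, ∑ x ∈ cell p, (w' x (ω x + ψ₀ x)) • (EuclideanSpace.proj x : EuclideanSpace ℝ ι →L[ℝ] ℝ))
            ∂(multivariateGaussian 0 Γ)))
          (EuclideanSpace.single x (1 : ℝ)) (EuclideanSpace.single y (1 : ℝ)) +
        ((∫ ω : EuclideanSpace ℝ ι, exp (-(∑ p ∈ C, ∑ x ∈ cell p, w x (ω x + ψ₀ x))) ∂(multivariateGaussian 0 Γ))⁻¹ •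
          (∫ ω : EuclideanSpace ℝ ι, exp (-(∑ p ∈ C, ∑ x ∈ cell p, w x (ω x + ψ₀ x))) •
            ((∑ p ∈ C, ∑ x ∈ cell p, (w'' x (ω x + ψ₀ x)) • ((EuclideanSpace.proj x : EuclideanSpace ℝ ι →L[ℝ] ℝ).smulRight
                (EuclideanSpace.proj x : EuclideanSpace ℝ ι →L[ℝ] ℝ))) -
              (∑ p ∈ C, ∑ x ∈ cell p, (w' x (ω x + ψ₀ x)) • (EuclideanSpace.proj x : EuclideanSpace ℝ ι →L[ℝ] ℝ)).smulRight
                (∑ p ∈ C, ∑ x ∈ cell p, (w' x (ω x + ψ₀ x)) • (EuclideanSpace.proj x : EuclideanSpace ℝ ι →L[ℝ] ℝ)))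
            ∂(multivariateGaussian 0 Γ)) +
        (((∫ ω : EuclideanSpace ℝ ι, exp (-(∑ p ∈ C, ∑ x ∈ cell p, w x (ω x + ψ₀ x))) ∂(multivariateGaussian 0 Γ)) ^ 2)⁻¹ •
          ∫ ω : EuclideanSpace ℝ ι, exp (-(∑ p ∈ C, ∑ x ∈ cell p, w x (ω x + ψ₀ x))) •
            (∑ p ∈ C, ∑ x ∈ cell p, (w' x (ω x + ψ₀ x)) • (EuclideanSpace.proj x : EuclideanSpace ℝ ι →L[ℝ] ℝ))
            ∂(multivariateGaussian 0 Γ)).smulRight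
          (∫ ω : EuclideanSpace ℝ ι, exp (-(∑ p ∈ C, ∑ x ∈ cell p, w x (ω x + ψ₀ x))) •
            (∑ p ∈ C, ∑ x ∈ cell p, (w' x (ω x + ψ₀ x)) • (EuclideanSpace.proj x : EuclideanSpace ℝ ι →L[ℝ] ℝ))
            ∂(multivariateGaussian 0 Γ)))
          (EuclideanSpace.single y (1 : ℝ)) (EuclideanSpace.single x (1 : ℝ))) / 2)) *ᵥ (WithLp.ofLp ζ) / 2 := by
  rw [linearPart_eq hΓ hΓop hdisj hw' hw'm hκ₀ hκ₁ hτ hδ hθ1 hκθ hstab hw'b C ψ₀ ζ,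
    quadraticPart_eq hΓ hΓop hdisj hw' hw'm hw''m hκ₀ hκ₁ hτ hδ hθ0 hθ1 hκθ hstab hw'b hw''b C ψ₀ ζ]
  ring

/-! ## §2. THE END: the cubic letter of the remainder in absorption terms -/

/-- **THE CUBIC LETTER OF THE DRESSED REMAINDER.**  Under (320)'s hypotheses, the third-order letters of (338) (`w ∈ C³`, `|w‴| ≤ κ₃`,
the three tilted moment letters along `ψ₀ + t·ζ`, uniform on the segment) and `0 ≤ L₁, L₂, L₃`:
`|log Z(ψ₀+ζ) − log Z(ψ₀) + ⟨b_D(ψ₀),ζ⟩ + ½ζᵀK_D(ψ₀)ζ| ≤ C₃·√Q(ζ)·Q(ζ)`, `Q(ζ) = Σ_Y ζ²`, with (386)'s explicit `C₃`. [folklore] -/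
theorem dressed_remainder_cubic (hΓ : Γ.PosSemidef) (hΓop : (γop • (1 : Matrix ι ι ℝ) - Γ).PosSemidef)
    (hdisj : ∀ p q, p ≠ q → Disjoint (cell p) (cell q))
    (hw' : ∀ x t, HasDerivAt (w x) (w' x t) t) (hw'' : ∀ x t, HasDerivAt (w' x) (w'' x t) t) (hw₃ : ∀ x t, HasDerivAt (w'' x) (w₃ x t) t)
    (hw₃m : ∀ x, Measurable (w₃ x)) (hκ₀ : 0 ≤ κ₀) (hκ₁ : 0 ≤ κ₁) (hκ₂ : 0 ≤ κ₂) (hκ₃ : 0 ≤ κ₃) (hτ : 0 < τ) (hδ : 0 < δ) (hθ0 : 0 < θ)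
    (hθ1 : θ < 1) (hκθ : (2 * κ₀ * (1 + τ) + 4 * δ) * γop ≤ θ) (hstab : ∀ x, ∀ u : ℝ, -(κ₀ * u ^ 2) ≤ w x u)
    (hw'b : ∀ x u, |w' x u| ≤ κ₁ * |u|) (hw''b : ∀ x u, |w'' x u| ≤ κ₂) (hw₃b : ∀ x u, |w₃ x u| ≤ κ₃) (C : Finset V) (ψ₀ ζ : EuclideanSpace ℝ ι)
    {L₁ L₂ L₃ : ℝ}
    (hI1 : ∀ t ∈ Set.Icc (0 : ℝ) 1, ∀ x ∈ C.biUnion cell, Integrable (fun ω : EuclideanSpace ℝ ι => exp (-(∑ x ∈ C.biUnion cell, w x (ω x + (ψ₀ x + t * ζ x)))) * |(ω x + (ψ₀ x + t * ζ x))|) (multivariateGaussian 0 Γ))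
    (hL1 : ∀ t ∈ Set.Icc (0 : ℝ) 1, ∀ x ∈ C.biUnion cell, ∫ ω : EuclideanSpace ℝ ι, exp (-(∑ x ∈ C.biUnion cell, w x (ω x + (ψ₀ x + t * ζ x)))) * |(ω x + (ψ₀ x + t * ζ x))| ∂(multivariateGaussian 0 Γ) ≤
      (∫ ω : EuclideanSpace ℝ ι, exp (-(∑ x ∈ C.biUnion cell, w x (ω x + (ψ₀ x + t * ζ x)))) ∂(multivariateGaussian 0 Γ)) * L₁)
    (hI2 : ∀ t ∈ Set.Icc (0 : ℝ) 1, ∀ x ∈ C.biUnion cell, Integrable (fun ω : EuclideanSpace ℝ ι => exp (-(∑ x ∈ C.biUnion cell, w x (ω x + (ψ₀ x + t * ζ x)))) * (ω x + (ψ₀ x + t * ζ x)) ^ 2) (multivariateGaussian 0 Γ))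
    (hL2 : ∀ t ∈ Set.Icc (0 : ℝ) 1, ∀ x ∈ C.biUnion cell, ∫ ω : EuclideanSpace ℝ ι, exp (-(∑ x ∈ C.biUnion cell, w x (ω x + (ψ₀ x + t * ζ x)))) * (ω x + (ψ₀ x + t * ζ x)) ^ 2 ∂(multivariateGaussian 0 Γ) ≤
      (∫ ω : EuclideanSpace ℝ ι, exp (-(∑ x ∈ C.biUnion cell, w x (ω x + (ψ₀ x + t * ζ x)))) ∂(multivariateGaussian 0 Γ)) * L₂)
    (hI3 : ∀ t ∈ Set.Icc (0 : ℝ) 1, ∀ x ∈ C.biUnion cell, Integrable (fun ω : EuclideanSpace ℝ ι => exp (-(∑ x ∈ C.biUnion cell, w x (ω x + (ψ₀ x + t * ζ x)))) * |(ω x + (ψ₀ x + t * ζ x))| ^ 3) (multivariateGaussian 0 Γ))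
    (hL3 : ∀ t ∈ Set.Icc (0 : ℝ) 1, ∀ x ∈ C.biUnion cell, ∫ ω : EuclideanSpace ℝ ι, exp (-(∑ x ∈ C.biUnion cell, w x (ω x + (ψ₀ x + t * ζ x)))) * |(ω x + (ψ₀ x + t * ζ x))| ^ 3 ∂(multivariateGaussian 0 Γ) ≤
      (∫ ω : EuclideanSpace ℝ ι, exp (-(∑ x ∈ C.biUnion cell, w x (ω x + (ψ₀ x + t * ζ x)))) ∂(multivariateGaussian 0 Γ)) * L₃)
    (hL₁ : 0 ≤ L₁) (hL₂ : 0 ≤ L₂) (hL₃ : 0 ≤ L₃) :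
    |Real.log (∫ ω : EuclideanSpace ℝ ι, exp (-(∑ x ∈ C.biUnion cell, w x (ω x + (ψ₀ x + ζ x)))) ∂(multivariateGaussian 0 Γ)) -
          Real.log (∫ ω : EuclideanSpace ℝ ι, exp (-(∑ x ∈ C.biUnion cell, w x (ω x + ψ₀ x))) ∂(multivariateGaussian 0 Γ)) +
        (fun x : ι => ((∫ ω : EuclideanSpace ℝ ι, exp (-(∑ p ∈ C, ∑ x ∈ cell p, w x (ω x + ψ₀ x))) ∂(multivariateGaussian 0 Γ))⁻¹ •
        ∫ ω : EuclideanSpace ℝ ι, exp (-(∑ p ∈ C, ∑ x ∈ cell p, w x (ω x + ψ₀ x))) •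
          (∑ p ∈ C, ∑ x ∈ cell p, (w' x (ω x + ψ₀ x)) • (EuclideanSpace.proj x : EuclideanSpace ℝ ι →L[ℝ] ℝ))
          ∂(multivariateGaussian 0 Γ)) (EuclideanSpace.single x (1 : ℝ))) ⬝ᵥ (WithLp.ofLp ζ) +
        (WithLp.ofLp ζ) ⬝ᵥ (Matrix.of fun x y : ι =>
      ((((∫ ω : EuclideanSpace ℝ ι, exp (-(∑ p ∈ C, ∑ x ∈ cell p, w x (ω x + ψ₀ x))) ∂(multivariateGaussian 0 Γ))⁻¹ •
          (∫ ω : EuclideanSpace ℝ ι, exp (-(∑ p ∈ C, ∑ x ∈ cell p, w x (ω x + ψ₀ x))) •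
            ((∑ p ∈ C, ∑ x ∈ cell p, (w'' x (ω x + ψ₀ x)) • ((EuclideanSpace.proj x : EuclideanSpace ℝ ι →L[ℝ] ℝ).smulRight
                (EuclideanSpace.proj x : EuclideanSpace ℝ ι →L[ℝ] ℝ))) -
              (∑ p ∈ C, ∑ x ∈ cell p, (w' x (ω x + ψ₀ x)) • (EuclideanSpace.proj x : EuclideanSpace ℝ ι →L[ℝ] ℝ)).smulRight
                (∑ p ∈ C, ∑ x ∈ cell p, (w' x (ω x + ψ₀ x)) • (EuclideanSpace.proj x : EuclideanSpace ℝ ι →L[ℝ] ℝ)))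
            ∂(multivariateGaussian 0 Γ)) +
        (((∫ ω : EuclideanSpace ℝ ι, exp (-(∑ p ∈ C, ∑ x ∈ cell p, w x (ω x + ψ₀ x))) ∂(multivariateGaussian 0 Γ)) ^ 2)⁻¹ •
          ∫ ω : EuclideanSpace ℝ ι, exp (-(∑ p ∈ C, ∑ x ∈ cell p, w x (ω x + ψ₀ x))) •
            (∑ p ∈ C, ∑ x ∈ cell p, (w' x (ω x + ψ₀ x)) • (EuclideanSpace.proj x : EuclideanSpace ℝ ι →L[ℝ] ℝ))
            ∂(multivariateGaussian 0 Γ)).smulRight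
          (∫ ω : EuclideanSpace ℝ ι, exp (-(∑ p ∈ C, ∑ x ∈ cell p, w x (ω x + ψ₀ x))) •
            (∑ p ∈ C, ∑ x ∈ cell p, (w' x (ω x + ψ₀ x)) • (EuclideanSpace.proj x : EuclideanSpace ℝ ι →L[ℝ] ℝ))
            ∂(multivariateGaussian 0 Γ)))
          (EuclideanSpace.single x (1 : ℝ)) (EuclideanSpace.single y (1 : ℝ)) +
        ((∫ ω : EuclideanSpace ℝ ι, exp (-(∑ p ∈ C, ∑ x ∈ cell p, w x (ω x + ψ₀ x))) ∂(multivariateGaussian 0 Γ))⁻¹ •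
          (∫ ω : EuclideanSpace ℝ ι, exp (-(∑ p ∈ C, ∑ x ∈ cell p, w x (ω x + ψ₀ x))) •
            ((∑ p ∈ C, ∑ x ∈ cell p, (w'' x (ω x + ψ₀ x)) • ((EuclideanSpace.proj x : EuclideanSpace ℝ ι →L[ℝ] ℝ).smulRight
                (EuclideanSpace.proj x : EuclideanSpace ℝ ι →L[ℝ] ℝ))) -
              (∑ p ∈ C, ∑ x ∈ cell p, (w' x (ω x + ψ₀ x)) • (EuclideanSpace.proj x : EuclideanSpace ℝ ι →L[ℝ] ℝ)).smulRight
                (∑ p ∈ C, ∑ x ∈ cell p, (w' x (ω x + ψ₀ x)) • (EuclideanSpace.proj x : EuclideanSpace ℝ ι →L[ℝ] ℝ)))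
            ∂(multivariateGaussian 0 Γ)) +
        (((∫ ω : EuclideanSpace ℝ ι, exp (-(∑ p ∈ C, ∑ x ∈ cell p, w x (ω x + ψ₀ x))) ∂(multivariateGaussian 0 Γ)) ^ 2)⁻¹ •
          ∫ ω : EuclideanSpace ℝ ι, exp (-(∑ p ∈ C, ∑ x ∈ cell p, w x (ω x + ψ₀ x))) •
            (∑ p ∈ C, ∑ x ∈ cell p, (w' x (ω x + ψ₀ x)) • (EuclideanSpace.proj x : EuclideanSpace ℝ ι →L[ℝ] ℝ))
            ∂(multivariateGaussian 0 Γ)).smulRight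
          (∫ ω : EuclideanSpace ℝ ι, exp (-(∑ p ∈ C, ∑ x ∈ cell p, w x (ω x + ψ₀ x))) •
            (∑ p ∈ C, ∑ x ∈ cell p, (w' x (ω x + ψ₀ x)) • (EuclideanSpace.proj x : EuclideanSpace ℝ ι →L[ℝ] ℝ))
            ∂(multivariateGaussian 0 Γ)))
          (EuclideanSpace.single y (1 : ℝ)) (EuclideanSpace.single x (1 : ℝ))) / 2)) *ᵥ (WithLp.ofLp ζ) / 2| ≤
      ((κ₁ ^ 3 * ((C.biUnion cell).card : ℝ) ^ 2 * L₃ + 3 * κ₂ * (κ₁ * Real.sqrt (C.biUnion cell).card * L₁) + κ₃) +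
          3 * (κ₁ * Real.sqrt (C.biUnion cell).card * L₁) * (κ₁ ^ 2 * (C.biUnion cell).card * L₂ + κ₂) + 2 * (κ₁ * Real.sqrt (C.biUnion cell).card * L₁) ^ 3) / 6 * Real.sqrt (∑ x ∈ C.biUnion cell, ζ x ^ 2) * (∑ x ∈ C.biUnion cell, ζ x ^ 2) := by
  have hw'm : ∀ x, Measurable (w' x) := fun x => (continuous_iff_continuousAt.2 fun t => (hw'' x t).continuousAt).measurable
  have hw''m : ∀ x, Measurable (w'' x) := fun x => (continuous_iff_continuousAt.2 fun t => (hw₃ x t).continuousAt).measurable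
  have h := cubic_letter_line hΓ hΓop (C.biUnion cell) hw' hw'' hw₃ hw₃m hκ₀ hκ₁ hκ₂ hκ₃ hτ hδ hθ0.le hθ1 hκθ hstab hw'b hw''b hw₃b
    (WithLp.ofLp ψ₀) (WithLp.ofLp ζ) hI1 hL1 hI2 hL2 hI3 hL3 hL₁ hL₂ hL₃
  rw [remainder_eq hΓ hΓop hdisj hw' hw'm hw''m hκ₀ hκ₁ hτ hδ hθ0 hθ1 hκθ hstab hw'b hw''b C ψ₀ ζ] at h
  exact h

end Road

/-! ## §3. Toy -/

/-- Toy (§1's algebra): `a − (−b) − (−c)∕2 = a + b + c∕2`. -/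
example (a b c : ℝ) : a - -b - -c / 2 = a + b + c / 2 := by ring

end Summit.QuantumFields.BalabanUV.T4Continuum.NE7b.SupExtractedPartsIdentified
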